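/-
Copyright (c) 2026 the pub-hodgecm-mathlib formalisation cell (harness21).  Prover seat hodgecm-mathlib-F0P2-p10 (g2), Track B «K2-LIT»,
#184♮ = hLiu418 = `stmt-HodgeConjecture-24832`; Road I v3 (#42F′ by uniqueness), LEAD F0P6-plan (g14) BATCH #62 (3) ∕ #64 (2) ∕ #65 (1): item (xii) «U2b AT THE PLACE» —
the `huniq` binder of ★ `K2LiuResidueMapCoinvariance.hslot_of_local_uniqueness` (plan (a)(b) of K2Liu-p26 (g2), credited).
-/
import Summits.HodgeConjecture.HodgeConjecture.Theorems.K2LiuNullConeMultiplicityOne     -- ★ V5 (K2Liu-p09): descent template; re-exports ★ V4 `K2LiuHomogeneousFunctionalLine`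
import Summits.HodgeConjecture.HodgeConjecture.Theorems.F0P2oLocallyConstantCoboundary     -- ★ p829212: Kudla's locally-constant partition trick with an exceptional set
import HarnessLib

/-!
# Crux `HLiu418`, Road I v3, item (xii) «U2b AT THE PLACE»: on the rank-one fibre of the moment map, the functionals that are
# `(N_w, ψ_{β₀})`-semi-invariant AND `(U(a′)_w, χ′_w)`-semi-invariant form ONE LINE — `∃ c, ∀ φ, ℓ φ = c · λ_w φ`

Cell `hodgecm-mathlib`, crux item hLiu418 = `stmt-HodgeConjecture-24832`; squad K2 ∕ K2Liu; LEAD F0P6-plan (g14) BATCH #62 (3) «(xii) (F4) U2b-local `huniq` … with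
K2Liu-p26's plan (a) ★ p829212 `mem_span_mul_sub_of_forall_eq_zero`, `X₀ := G⁻¹(β₀)`, (b) one `U(a′)_w`-orbit ⇒ one line», #64 (2), #65 (1); desk K2Liu-p02 (g8);
prover F0P2-p10 (g2).  THEOREMS ONLY (no `def`, no instance declaration, no notation, no named-fact hypothesis, no `sorry`); lane
`--supports stmt-HodgeConjecture-24832 --as helper` (count-neutral).  WRITTEN ABSTRACT OVER THE MODEL, in the currency of ★ U2a `K2LiuLineNoRankTwoCoinvariants`,
★ V4 `K2LiuHomogeneousFunctionalLine` and ★ V5 `K2LiuNullConeMultiplicityOne`: no K2Liu letter is used here.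

THE MATHEMATICS ([KudlaRallis1994, §3]; [Rallis1984, §4]; [MoeglinVignerasWaldspurger1987, Chap. 3 §IV.4–IV.5]; [BernsteinZelevinsky1976, §1.18, §2.30–2.33]).  In the Schrödinger
model `𝒮(𝕏_w)` of the local Weil representation of `U(𝔻_w) × U(⟨a′⟩_w)` (`⟨a′⟩` a hermitian LINE) the Siegel unipotent radical `N_w ≅ Herm₂(L_w)` acts by the locally
constant MULTIPLIERS `u_n(x) = ψ_v(⟪b(n), G(x)⟫)` of the moment map `G(x) = a′ · x x*`, and the compact-or-split torus `U(a′)_w = U(1)(L_w)` acts through its action on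
`𝕏_w`.  A functional `ℓ` with `ℓ(u_n · φ) = ψ_{β₀}(n) ℓ(φ)` (`β₀ = diag(a′, 0)`) is SUPPORTED on the fibre `X₀ = G⁻¹(β₀) = {x₁ x̄₁ = 1, x₂ = 0}` (Kudla's partition trick:
off `X₀` some `(ψ_{β₀}(n))⁻¹ u_n` moves the point — ★ U2a §2 `exists_addChar_pairing_ne_one`), and `X₀` is ONE closed `U(a′)_w`-orbit; the `(U(a′)_w, χ′_w)`-semi-invariant
functionals on the test functions of one orbit form a line (★ V4).  Hence: **if `λ_w ≠ 0` and `ℓ` are both doubly semi-invariant then `ℓ = c · λ_w`** — the LOCAL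
UNIQUENESS «U2b at the place `w`» that ★ `K2LiuResidueMapCoinvariance.hslot_of_local_uniqueness` takes BY VALUE as `huniq`, and through it ★ U2e
`K2LiuRestrictedTensorFunctionalFactorisation.exists_unique_slotwise_factorisation`.

* §1 SUPPORT ON THE FIBRE (`apply_eq_zero_of_eqOn_fibre`, `apply_eq_of_eqOn_fibre`): `T : (X → ℂ) →ₗ ℂ` with `T (u z · F) = χ z · T F` on lcc functions (locally constant,
  compactly supported), `χ z ≠ 0`, every point off `X₀` moved (`∃ z, u z x ≠ χ z`) ⇒ `T F = 0` for every lcc `F` vanishing on `X₀` — ★ p829212 with exceptional set `X₀`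
  for the multipliers `(χ z)⁻¹ · u z` (★ U2a §1 is the case `X₀ = ∅`).
* §2 ONE ORBIT ⇒ ONE LINE (`exists_forall_apply_eq_const_mul_of_fibre`): ★ V5's theorem WITHOUT the vertex — `Γ` totally disconnected σ-compact with a compact open `K₀`,
  `χ′ : Γ →* ℂ` trivial on `K₀`, `X` a Hausdorff locally compact `Γ`-space, `X₀ ⊆ X` closed, `Γ`-stable, ONE `Γ`-orbit, every lcc function on `X₀` extending to an lcc function
  on `X` (by value; ★ V2c `K2LiuTDRestrictionOnto.exists_extension` at the instance); two functionals `χ′`-semi-invariant on lcc functions (★ V4's convention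
  `T (fun z => F (γ • z)) = χ′ γ · T F`) and killing the lcc functions vanishing on `X₀`, the first one `≠ 0` ⇒ `T₂ = c · T₁` on lcc functions (DESCENT to the test
  functions of the orbit by `LinearMap.exists_extend`, then ★ V4 `exists_forall_apply_eq_const_mul`).
* §3 THE `huniq` CURRENCY (`exists_forall_apply_eq_mul_of_semiInvariant`): for `lam ℓ : ↥(SchwartzBruhat X) →ₗ[ℂ] ℂ` both `(u, χ)`- and `(Γ, χ′)`-semi-invariant and
  `lam ≠ 0`: **`∃ c : ℂ, ∀ φ, ℓ φ = c * lam φ`** — the conclusion of `huniq i` in ★ `hslot_of_local_uniqueness` token-shape at `V i := ↥(SchwartzBruhat 𝕏_w)`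
  (extend both to `X → ℂ`, §1, §2).

HONEST SCOPE (LEAD RULING M-158i (d)).  This is U2b-LOCAL: «dimension ≤ 1 with a named non-zero doubly semi-invariant reference `λ_w`».  It pays `huniq` (hence ★ U2e's `hslot`)
for EACH global coefficient functional separately; it does NOT by itself pay FACE-L′'s row `h₁ : coeff β₀ ∘ T₁ = c₁ • (coeff β₀ ∘ T₂)` on `D_V`, whose `E`-side comparison
(including the degenerate case `coeff β₀ ∘ T₂|_{D_V} = 0`) is the (F4) GLOBAL assembly row.
HONEST LABEL.  Count-neutral helper, closes no socket: `HC_CM` is proved only modulo the 7 printed citations (2 remaining named inputs: hLiu418 =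
`stmt-HodgeConjecture-24832`, h413 = `stmt-HodgeConjecture-24833`) until rung 0 closes.

## References
* [KudlaRallis1994] S. S. Kudla, S. Rallis, *A regularized Siegel–Weil formula: the first term identity*, Ann. of Math. 140 (1994), §3 (local uniqueness on the
  rank-one orbit).
* [Rallis1984] S. Rallis, *On the Howe duality conjecture*, Compositio Math. 51 (1984) 333–399, §4 (twisted Jacquet modules of the oscillator representation along the
  Siegel unipotent radical are supported on the represented `β`).
* [MoeglinVignerasWaldspurger1987] C. Mœglin, M.-F. Vignéras, J.-L. Waldspurger, LNM 1291 (1987), Chap. 3 §IV.4 (multiplicity one in rank one), §IV.5 (filtration de Kudla).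
* [BernsteinZelevinsky1976] I. N. Bernstein, A. V. Zelevinsky, Russian Math. Surveys 31 (1976), §1.18–1.21 (invariant distributions on homogeneous `ℓ`-spaces),
  §2.30–2.33 (coinvariants).
* [Kudla1986] S. S. Kudla, *On the local theta-correspondence*, Invent. Math. 83 (1986), proof of Thm. 2.8 (the locally-constant partition trick).
-/

set_option autoImplicit false
set_option linter.dupNamespace false -- the mandated namespace repeats `HodgeConjecture.HodgeConjecture`

noncomputable section

open Set Filter Topology MulAction
open scoped Pointwise
open Literature.NumberTheory.Automorphic
open Summit.HodgeConjecture.HodgeConjecture.Cruxes.H413.F0P2oLocallyConstantCoboundary (mem_span_mul_sub_of_forall_eq_zero)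
open Summit.HodgeConjecture.HodgeConjecture.Cruxes.HLiu418.K2LiuHomogeneousFunctionalLine (exists_forall_apply_eq_const_mul)

namespace Summit.HodgeConjecture.HodgeConjecture.Cruxes.HLiu418.K2LiuLineRankOneLocalUniqueness

/-! ## §1 Support on the fibre: a functional semi-invariant under locally constant multipliers kills the test functions vanishing on the fixed fibre -/

section Support

variable {X : Type*} [TopologicalSpace X] {Z : Type*}

/-- **SUPPORT ON THE FIBRE** (Kudla's partition trick with exceptional set `X₀`, ★ p829212).  Let `T` be a linear functional on `X → ℂ` with
`T (u z · F) = χ z · T F` for every lcc `F` and every `z` (locally constant multipliers `u z`, non-zero scalars `χ z`), and suppose every point OFF `X₀` is MOVED: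
`∃ z, u z x ≠ χ z`.  Then `T F = 0` for every lcc `F` vanishing on `X₀` — `F` is a finite sum of twisted coboundaries `(χ z)⁻¹ u z · φ − φ`, each killed by `T`.
At the instance: `Z = N_w ≅ Herm₂(L_w)`, `u n = ψ_v(⟪b(n), G(·)⟫)`, `χ = ψ_{β₀}`, `X₀ = G⁻¹(β₀)` (★ U2a §2 `exists_addChar_pairing_ne_one` pays the moving hypothesis).
[cite: Kudla1986, proof of Thm. 2.8] [cite: Rallis1984, §4] [cite: BernsteinZelevinsky1976, §2.30–2.33] -/
theorem apply_eq_zero_of_eqOn_fibre (T : (X → ℂ) →ₗ[ℂ] ℂ) (u : Z → X → ℂ) (hu : ∀ z, IsLocallyConstant (u z)) (χ : Z → ℂ) (hχ0 : ∀ z, χ z ≠ 0)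
    (hT : ∀ F : X → ℂ, IsLocallyConstant F → HasCompactSupport F → ∀ z : Z, T (u z * F) = χ z * T F)
    (X₀ : Set X) (hsep : ∀ x, x ∉ X₀ → ∃ z, u z x ≠ χ z)
    {F : X → ℂ} (hF : IsLocallyConstant F) (hFs : HasCompactSupport F) (hF₀ : ∀ x ∈ X₀, F x = 0) : T F = 0 := by
  -- Kudla's lemma for the multipliers `(χ z)⁻¹ · u z`, exceptional set `X₀`
  have hmem := mem_span_mul_sub_of_forall_eq_zero (Set.range fun (z : Z) (x : X) => (χ z)⁻¹ * u z x)
    (by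
      rintro _ ⟨z, rfl⟩
      exact (hu z).comp fun t => (χ z)⁻¹ * t) X₀
    (fun x hx => by
      obtain ⟨z, hz⟩ := hsep x hx
      refine ⟨_, ⟨z, rfl⟩, fun h => hz ?_⟩
      have h' : (χ z)⁻¹ * u z x = 1 := h
      calc u z x = χ z * ((χ z)⁻¹ * u z x) := by rw [← mul_assoc, mul_inv_cancel₀ (hχ0 z), one_mul]
        _ = χ z := by rw [h', mul_one]) ⟨hF, hFs⟩ hF₀
  -- `T` kills every generator, hence the span
  clear hF hFs hF₀
  induction hmem using Submodule.span_induction with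
  | mem g hg =>
      obtain ⟨_, ⟨z, rfl⟩, φ, hφ, rfl⟩ := hg
      show T ((fun x => (χ z)⁻¹ * u z x) * φ - φ) = 0
      have h1 : (fun x => (χ z)⁻¹ * u z x) * φ = (χ z)⁻¹ • (u z * φ) := by
        funext x
        simp only [Pi.mul_apply, Pi.smul_apply, smul_eq_mul, mul_assoc]
      rw [map_sub, h1, map_smul, hT φ hφ.1 hφ.2 z, smul_eq_mul, ← mul_assoc, inv_mul_cancel₀ (hχ0 z), one_mul, sub_self]
  | zero => exact map_zero T
  | add a b _ _ ha hb => rw [map_add, ha, hb, add_zero]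
  | smul c a _ ha => rw [map_smul, ha, smul_zero]

/-- Hence the value of such a `T` on an lcc function depends only on its restriction to the fibre `X₀`. [cite: BernsteinZelevinsky1976, §1.5] [cite: Rallis1984, §4] -/
theorem apply_eq_of_eqOn_fibre (T : (X → ℂ) →ₗ[ℂ] ℂ) (u : Z → X → ℂ) (hu : ∀ z, IsLocallyConstant (u z)) (χ : Z → ℂ) (hχ0 : ∀ z, χ z ≠ 0)
    (hT : ∀ F : X → ℂ, IsLocallyConstant F → HasCompactSupport F → ∀ z : Z, T (u z * F) = χ z * T F)
    (X₀ : Set X) (hsep : ∀ x, x ∉ X₀ → ∃ z, u z x ≠ χ z)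
    {F F' : X → ℂ} (hF : IsLocallyConstant F) (hFs : HasCompactSupport F) (hF' : IsLocallyConstant F') (hF's : HasCompactSupport F')
    (hagree : ∀ x ∈ X₀, F x = F' x) : T F = T F' := by
  rw [← sub_eq_zero, ← map_sub]
  exact apply_eq_zero_of_eqOn_fibre T u hu χ hχ0 hT X₀ hsep (hF.comp₂ hF' fun a b => a - b) (hFs.sub hF's)
    fun x hx => by rw [Pi.sub_apply, hagree x hx, sub_self]

end Support

/-! ## §2 One orbit ⇒ one line: ★ V5's multiplicity one WITHOUT a vertex -/

section Main

variable {Γ : Type*} [Group Γ] [TopologicalSpace Γ] [IsTopologicalGroup Γ] [TotallyDisconnectedSpace Γ] [SigmaCompactSpace Γ]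
  {X : Type*} [TopologicalSpace X] [T2Space X] [LocallyCompactSpace X] [MulAction Γ X] [ContinuousSMul Γ X]

omit [LocallyCompactSpace X] [MulAction Γ X] [ContinuousSMul Γ X] [T2Space X] in
/-- restriction to the closed fibre: an lcc function on `X` restricts to an lcc function on `X₀`. [cite: BernsteinZelevinsky1976, §1.3] -/
theorem isLocallyConstant_hasCompactSupport_restrict_fibre (X₀ : Set X) (hX₀c : IsClosed X₀) {F : X → ℂ} (hF : IsLocallyConstant F)
    (hFs : HasCompactSupport F) :
    IsLocallyConstant (fun x : ↥X₀ => F x) ∧ HasCompactSupport (fun x : ↥X₀ => F x) :=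
  ⟨hF.comp_continuous continuous_subtype_val, hFs.comp_isClosedEmbedding hX₀c.isClosedEmbedding_subtypeVal⟩

/-- **ONE ORBIT ⇒ ONE LINE.**  `Γ` totally disconnected σ-compact with a compact open subgroup `K₀`, `χ′ : Γ →* ℂ` trivial on `K₀`; `X` a Hausdorff locally compact `Γ`-space;
`X₀ ⊆ X` closed, `Γ`-stable and ONE `Γ`-orbit; every lcc function on `X₀` extends to an lcc function on `X` (by value — ★ V2c at the instance).  If `T₁, T₂` are
`χ′`-semi-invariant on lcc functions (★ V4's convention) and kill the lcc functions vanishing on `X₀` (§1 at the instance), and `T₁ ≠ 0` on lcc functions, then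
**`T₂ = c · T₁` on lcc functions** — ★ V5 `exists_forall_apply_eq_const_mul_of_nullCone` with the vertex removed: DESCENT to the test functions of the orbit
(`LinearMap.exists_extend`), then ★ V4 `exists_forall_apply_eq_const_mul` (orbit maps are open by `isOpenMap_smul_of_sigmaCompact`).
[cite: KudlaRallis1994, §3] [cite: MoeglinVignerasWaldspurger1987, Chap. 3 §IV.4] [cite: BernsteinZelevinsky1976, §1.18–1.21] -/
theorem exists_forall_apply_eq_const_mul_of_fibre (K₀ : Subgroup Γ) (hK₀o : IsOpen (K₀ : Set Γ)) (hK₀c : IsCompact (K₀ : Set Γ))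
    (χ' : Γ →* ℂ) (hχ' : ∀ k ∈ K₀, χ' k = 1)
    (X₀ : Set X) (hX₀c : IsClosed X₀) (hX₀Γ : ∀ γ : Γ, ∀ x ∈ X₀, γ • x ∈ X₀)
    (htrans : ∀ x ∈ X₀, ∀ y ∈ X₀, ∃ γ : Γ, γ • x = y)
    (hext : ∀ f : ↥X₀ → ℂ, IsLocallyConstant f → HasCompactSupport f →
      ∃ F : X → ℂ, IsLocallyConstant F ∧ HasCompactSupport F ∧ ∀ x : ↥X₀, F x = f x)
    (T₁ T₂ : (X → ℂ) →ₗ[ℂ] ℂ)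
    (hT₁ : ∀ F : X → ℂ, IsLocallyConstant F → HasCompactSupport F → ∀ γ : Γ, T₁ (fun z => F (γ • z)) = χ' γ * T₁ F)
    (hT₂ : ∀ F : X → ℂ, IsLocallyConstant F → HasCompactSupport F → ∀ γ : Γ, T₂ (fun z => F (γ • z)) = χ' γ * T₂ F)
    (hT₁N : ∀ F : X → ℂ, IsLocallyConstant F → HasCompactSupport F → (∀ x ∈ X₀, F x = 0) → T₁ F = 0)
    (hT₂N : ∀ F : X → ℂ, IsLocallyConstant F → HasCompactSupport F → (∀ x ∈ X₀, F x = 0) → T₂ F = 0)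
    {F₀ : X → ℂ} (hF₀ : IsLocallyConstant F₀) (hF₀s : HasCompactSupport F₀) (hne : T₁ F₀ ≠ 0) :
    ∃ c : ℂ, ∀ F : X → ℂ, IsLocallyConstant F → HasCompactSupport F → T₂ F = c * T₁ F := by
  classical
  have hcontX : ∀ γ : Γ, Continuous fun x : X => γ • x := fun γ => continuous_const_smul γ
  -- the fibre `X₀` as a `Γ`-space
  letI : MulAction Γ ↥X₀ :=
    { smul := fun γ x => ⟨γ • (x : X), hX₀Γ γ x x.2⟩
      one_smul := fun x => Subtype.ext (one_smul Γ (x : X))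
      mul_smul := fun a b x => Subtype.ext (mul_smul a b (x : X)) }
  have hcoe : ∀ (γ : Γ) (x : ↥X₀), (((γ • x : ↥X₀)) : X) = γ • (x : X) := fun _ _ => rfl
  haveI : ContinuousSMul Γ ↥X₀ :=
    ⟨(continuous_smul.comp (continuous_fst.prodMk (continuous_subtype_val.comp continuous_snd))).subtype_mk _⟩
  haveI : LocallyCompactSpace ↥X₀ := hX₀c.isLocallyClosed.locallyCompactSpace
  haveI : IsPretransitive Γ ↥X₀ :=
    ⟨fun x y => by obtain ⟨γ, hγ⟩ := htrans x x.2 y y.2; exact ⟨γ, Subtype.ext hγ⟩⟩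
  have hopen : ∀ x : ↥X₀, IsOpenMap fun γ : Γ => γ • x := fun x => isOpenMap_smul_of_sigmaCompact x
  -- DESCENT: every `T` killing the lcc functions vanishing on `X₀` descends to the test functions of the fibre
  have descend : ∀ T : (X → ℂ) →ₗ[ℂ] ℂ, (∀ F : X → ℂ, IsLocallyConstant F → HasCompactSupport F → (∀ x ∈ X₀, F x = 0) → T F = 0) →
      ∃ Td : (↥X₀ → ℂ) →ₗ[ℂ] ℂ, ∀ F : X → ℂ, IsLocallyConstant F → HasCompactSupport F → Td (fun x => F x) = T F := by
    intro T hTN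
    choose ext hext1 hext2 hext3 using hext
    have indep : ∀ {F F' : X → ℂ}, IsLocallyConstant F → HasCompactSupport F → IsLocallyConstant F' → HasCompactSupport F' →
        (∀ x : ↥X₀, F x = F' x) → T F = T F' := by
      intro F F' hF hFs hF' hF's hag
      rw [← sub_eq_zero, ← map_sub]
      exact hTN _ (hF.comp₂ hF' fun a b => a - b) (hFs.sub hF's) fun x hx => by rw [Pi.sub_apply, hag ⟨x, hx⟩, sub_self]
    -- the lcc submodule of the fibre and the functional on it
    let S : Submodule ℂ (↥X₀ → ℂ) :=
      { carrier := {f | IsLocallyConstant f ∧ HasCompactSupport f}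
        add_mem' := fun {f g} hf hg => ⟨hf.1.comp₂ hg.1 fun a b => a + b, hf.2.add hg.2⟩
        zero_mem' := ⟨IsLocallyConstant.const 0, HasCompactSupport.intro isCompact_empty fun _ _ => rfl⟩
        smul_mem' := fun c f hf => ⟨hf.1.comp fun z => c • z, hf.2.smul_left⟩ }
    let t : S →ₗ[ℂ] ℂ :=
      { toFun := fun f => T (ext f.1 f.2.1 f.2.2)
        map_add' := fun f g => by
          show T (ext (f.1 + g.1) (S.add_mem f.2 g.2).1 (S.add_mem f.2 g.2).2) = T (ext f.1 f.2.1 f.2.2) + T (ext g.1 g.2.1 g.2.2)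
          rw [← map_add]
          refine indep (hext1 _ _ _) (hext2 _ _ _) ((hext1 _ _ _).comp₂ (hext1 _ _ _) fun a b => a + b) ((hext2 _ _ _).add (hext2 _ _ _)) fun x => ?_
          rw [hext3, Pi.add_apply, Pi.add_apply, hext3, hext3]
        map_smul' := fun c f => by
          show T (ext (c • f.1) (S.smul_mem c f.2).1 (S.smul_mem c f.2).2) = c • T (ext f.1 f.2.1 f.2.2)
          rw [← map_smul]
          refine indep (hext1 _ _ _) (hext2 _ _ _) ((hext1 _ _ _).comp fun z => c • z) (hext2 _ _ _).smul_left fun x => ?_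
          rw [hext3, Pi.smul_apply, Pi.smul_apply, hext3] }
    obtain ⟨Td, hTd⟩ := LinearMap.exists_extend t
    refine ⟨Td, fun F hF hFs => ?_⟩
    have hres := isLocallyConstant_hasCompactSupport_restrict_fibre X₀ hX₀c hF hFs
    have h1 : Td (fun x => F x) = t ⟨fun x => F x, hres⟩ := by
      rw [← hTd]; rfl
    rw [h1]
    show T (ext (fun x : ↥X₀ => F x) hres.1 hres.2) = T F
    exact indep (hext1 _ _ _) (hext2 _ _ _) hF hFs fun x => hext3 _ _ _ x
  obtain ⟨Td₁, hTd₁⟩ := descend T₁ hT₁N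
  obtain ⟨Td₂, hTd₂⟩ := descend T₂ hT₂N
  -- the descended functionals are `χ′`-semi-invariant on the test functions of the fibre
  have hsemi : ∀ (T : (X → ℂ) →ₗ[ℂ] ℂ) (Td : (↥X₀ → ℂ) →ₗ[ℂ] ℂ),
      (∀ F : X → ℂ, IsLocallyConstant F → HasCompactSupport F → ∀ γ : Γ, T (fun z => F (γ • z)) = χ' γ * T F) →
      (∀ F : X → ℂ, IsLocallyConstant F → HasCompactSupport F → Td (fun x => F x) = T F) →
      ∀ f : ↥X₀ → ℂ, IsLocallyConstant f → HasCompactSupport f → ∀ γ : Γ, Td (fun z => f (γ • z)) = χ' γ * Td f := by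
    intro T Td hT hTd f hf hfs γ
    obtain ⟨F, hF, hFs, hFf⟩ := hext f hf hfs
    have hG : IsLocallyConstant fun z : X => F (γ • z) := hF.comp_continuous (hcontX γ)
    have hGs : HasCompactSupport fun z : X => F (γ • z) := hFs.comp_homeomorph (Homeomorph.smul γ)
    have hf' : (fun z : ↥X₀ => f (γ • z)) = fun z => F ((γ • z : ↥X₀) : X) := funext fun z => (hFf _).symm
    have hf0 : f = fun z : ↥X₀ => F z := funext fun z => (hFf z).symm
    rw [hf', hf0, hTd F hF hFs]
    simp only [hcoe]
    rw [hTd _ hG hGs, hT F hF hFs γ]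
  have hs₁ := hsemi T₁ Td₁ hT₁ hTd₁
  have hs₂ := hsemi T₂ Td₂ hT₂ hTd₂
  -- either `Td₁ ≠ 0` (then ★ V4 gives the constant) or `T₁` vanishes on lcc functions (contradicting `hne`)
  by_cases h0 : ∃ f₀ : ↥X₀ → ℂ, IsLocallyConstant f₀ ∧ HasCompactSupport f₀ ∧ Td₁ f₀ ≠ 0
  · obtain ⟨f₀, hf₀, hf₀s, hf₀ne⟩ := h0
    obtain ⟨c, hc⟩ := exists_forall_apply_eq_const_mul K₀ hK₀o hK₀c hopen χ' hχ' Td₁ Td₂ hs₁ hs₂ hf₀ hf₀s hf₀ne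
    refine ⟨c, fun F hF hFs => ?_⟩
    have hres := isLocallyConstant_hasCompactSupport_restrict_fibre X₀ hX₀c hF hFs
    rw [← hTd₁ F hF hFs, ← hTd₂ F hF hFs, hc _ hres.1 hres.2]
  · exfalso
    push Not at h0
    have hres := isLocallyConstant_hasCompactSupport_restrict_fibre X₀ hX₀c hF₀ hF₀s
    exact hne (by rw [← hTd₁ F₀ hF₀ hF₀s]; exact h0 _ hres.1 hres.2)

/-! ## §3 The `huniq` currency: functionals on `↥(SchwartzBruhat X)` -/

/-- **U2b AT THE PLACE, IN THE CURRENCY OF ★ `hslot_of_local_uniqueness`'s `huniq`.**  Same `Γ, K₀, χ′, X, X₀` as §2 (`X₀` closed, `Γ`-stable, one `Γ`-orbit, extension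
by value), plus the multipliers `u z` (locally constant), scalars `χ z ≠ 0` and the moving hypothesis off `X₀` of §1.  Let `lam ℓ : ↥(SchwartzBruhat X) →ₗ[ℂ] ℂ` be
DOUBLY SEMI-INVARIANT — `lam φ′ = χ z · lam φ` whenever `φ′ = u z · φ`, and `lam φ′ = χ′ γ · lam φ` whenever `φ′ = φ ∘ (γ • ·)` (the same for `ℓ`) — and `lam ≠ 0`.  THEN
**`∃ c : ℂ, ∀ φ, ℓ φ = c * lam φ`** (extend both to `X → ℂ` by `LinearMap.exists_extend`; §1 gives the support condition, §2 the line).  At the instance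
(`X = 𝕏_w`, `Z = N_w`, `Γ = U(a′)_w`, `X₀ = G⁻¹(β₀)`, `lam = λ_w`) this is `huniq i` of ★ `K2LiuResidueMapCoinvariance.hslot_of_local_uniqueness` at `V i := ↥(SchwartzBruhat 𝕏_w)`.
ISOTYPY (LEAD RULING M-158k (c)): `lam` and `ℓ` are semi-invariant for ONE AND THE SAME character `χ′` of `Γ` — at the instance `χ′ := χ₀,v`, the local component of the central ∕
theta character of record (FACE-L″'s `hχZ`) — so the brick compares the `χ₀,v`-ISOTYPIC functionals of the residue side and of the theta side, and nothing else.
[cite: KudlaRallis1994, §3] [cite: Rallis1984, §4] [cite: MoeglinVignerasWaldspurger1987, Chap. 3 §IV.4] [cite: BernsteinZelevinsky1976, §1.18] -/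
theorem exists_forall_apply_eq_mul_of_semiInvariant (K₀ : Subgroup Γ) (hK₀o : IsOpen (K₀ : Set Γ)) (hK₀c : IsCompact (K₀ : Set Γ))
    (χ' : Γ →* ℂ) (hχ' : ∀ k ∈ K₀, χ' k = 1)
    (X₀ : Set X) (hX₀c : IsClosed X₀) (hX₀Γ : ∀ γ : Γ, ∀ x ∈ X₀, γ • x ∈ X₀)
    (htrans : ∀ x ∈ X₀, ∀ y ∈ X₀, ∃ γ : Γ, γ • x = y)
    (hext : ∀ f : ↥X₀ → ℂ, IsLocallyConstant f → HasCompactSupport f →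
      ∃ F : X → ℂ, IsLocallyConstant F ∧ HasCompactSupport F ∧ ∀ x : ↥X₀, F x = f x)
    {Z : Type*} (u : Z → X → ℂ) (hu : ∀ z, IsLocallyConstant (u z)) (χ : Z → ℂ) (hχ0 : ∀ z, χ z ≠ 0)
    (hsep : ∀ x, x ∉ X₀ → ∃ z, u z x ≠ χ z)
    (lam ℓ : ↥(SchwartzBruhat X) →ₗ[ℂ] ℂ)
    (hlamZ : ∀ (z : Z) (φ φ' : ↥(SchwartzBruhat X)), (φ' : X → ℂ) = u z * (φ : X → ℂ) → lam φ' = χ z * lam φ)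
    (hlamΓ : ∀ (γ : Γ) (φ φ' : ↥(SchwartzBruhat X)), ((φ' : X → ℂ) = fun x => (φ : X → ℂ) (γ • x)) → lam φ' = χ' γ * lam φ)
    (hℓZ : ∀ (z : Z) (φ φ' : ↥(SchwartzBruhat X)), (φ' : X → ℂ) = u z * (φ : X → ℂ) → ℓ φ' = χ z * ℓ φ)
    (hℓΓ : ∀ (γ : Γ) (φ φ' : ↥(SchwartzBruhat X)), ((φ' : X → ℂ) = fun x => (φ : X → ℂ) (γ • x)) → ℓ φ' = χ' γ * ℓ φ)
    (hlam : ∃ φ : ↥(SchwartzBruhat X), lam φ ≠ 0) :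
    ∃ c : ℂ, ∀ φ : ↥(SchwartzBruhat X), ℓ φ = c * lam φ := by
  have hcontX : ∀ γ : Γ, Continuous fun x : X => γ • x := fun γ => continuous_const_smul γ
  -- extend both functionals to `X → ℂ`
  obtain ⟨T₁, hT₁⟩ := LinearMap.exists_extend lam
  obtain ⟨T₂, hT₂⟩ := LinearMap.exists_extend ℓ
  have hT₁v : ∀ (F : X → ℂ) (hF : IsLocallyConstant F) (hFs : HasCompactSupport F), T₁ F = lam ⟨F, hF, hFs⟩ := fun F hF hFs => by
    rw [← hT₁]; rfl
  have hT₂v : ∀ (F : X → ℂ) (hF : IsLocallyConstant F) (hFs : HasCompactSupport F), T₂ F = ℓ ⟨F, hF, hFs⟩ := fun F hF hFs => by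
    rw [← hT₂]; rfl
  -- transfer the two semi-invariances to the extensions (on lcc functions)
  have semiZ : ∀ (Λ : ↥(SchwartzBruhat X) →ₗ[ℂ] ℂ) (T : (X → ℂ) →ₗ[ℂ] ℂ),
      (∀ (F : X → ℂ) (hF : IsLocallyConstant F) (hFs : HasCompactSupport F), T F = Λ ⟨F, hF, hFs⟩) →
      (∀ (z : Z) (φ φ' : ↥(SchwartzBruhat X)), (φ' : X → ℂ) = u z * (φ : X → ℂ) → Λ φ' = χ z * Λ φ) →
      ∀ F : X → ℂ, IsLocallyConstant F → HasCompactSupport F → ∀ z : Z, T (u z * F) = χ z * T F := by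
    intro Λ T hTv hΛ F hF hFs z
    rw [hTv (u z * F) ((hu z).mul hF) hFs.mul_left, hTv F hF hFs]
    exact hΛ z ⟨F, hF, hFs⟩ ⟨u z * F, (hu z).mul hF, hFs.mul_left⟩ rfl
  have semiΓ : ∀ (Λ : ↥(SchwartzBruhat X) →ₗ[ℂ] ℂ) (T : (X → ℂ) →ₗ[ℂ] ℂ),
      (∀ (F : X → ℂ) (hF : IsLocallyConstant F) (hFs : HasCompactSupport F), T F = Λ ⟨F, hF, hFs⟩) →
      (∀ (γ : Γ) (φ φ' : ↥(SchwartzBruhat X)), ((φ' : X → ℂ) = fun x => (φ : X → ℂ) (γ • x)) → Λ φ' = χ' γ * Λ φ) →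
      ∀ F : X → ℂ, IsLocallyConstant F → HasCompactSupport F → ∀ γ : Γ, T (fun z => F (γ • z)) = χ' γ * T F := by
    intro Λ T hTv hΛ F hF hFs γ
    have hG : IsLocallyConstant fun z : X => F (γ • z) := hF.comp_continuous (hcontX γ)
    have hGs : HasCompactSupport fun z : X => F (γ • z) := hFs.comp_homeomorph (Homeomorph.smul γ)
    rw [hTv _ hG hGs, hTv F hF hFs]
    exact hΛ γ ⟨F, hF, hFs⟩ ⟨fun z => F (γ • z), hG, hGs⟩ rfl
  -- non-vanishing of `T₁` on one lcc function
  obtain ⟨φ₀, hφ₀⟩ := hlam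
  have hne : T₁ (φ₀ : X → ℂ) ≠ 0 := by
    rw [hT₁v (φ₀ : X → ℂ) φ₀.2.1 φ₀.2.2]
    exact hφ₀
  obtain ⟨c, hc⟩ := exists_forall_apply_eq_const_mul_of_fibre K₀ hK₀o hK₀c χ' hχ' X₀ hX₀c hX₀Γ htrans hext T₁ T₂
    (semiΓ lam T₁ hT₁v hlamΓ) (semiΓ ℓ T₂ hT₂v hℓΓ)
    (fun F hF hFs hF₀ => apply_eq_zero_of_eqOn_fibre T₁ u hu χ hχ0 (semiZ lam T₁ hT₁v hlamZ) X₀ hsep hF hFs hF₀)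
    (fun F hF hFs hF₀ => apply_eq_zero_of_eqOn_fibre T₂ u hu χ hχ0 (semiZ ℓ T₂ hT₂v hℓZ) X₀ hsep hF hFs hF₀)
    φ₀.2.1 φ₀.2.2 hne
  refine ⟨c, fun φ => ?_⟩
  rw [← hT₁v (φ : X → ℂ) φ.2.1 φ.2.2, ← hT₂v (φ : X → ℂ) φ.2.1 φ.2.2]
  exact hc _ φ.2.1 φ.2.2

end Main

end Summit.HodgeConjecture.HodgeConjecture.Cruxes.HLiu418.K2LiuLineRankOneLocalUniqueness

end
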